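import Mathlib
import Summits.Ventures.PercRepro2.HCov
import Summits.Ventures.PercRepro2.HCovSwap
import Summits.Ventures.PercRepro2.BHKMixed
import Summits.Ventures.PercRepro2.J1CoincTable
import Summits.Ventures.PercRepro2.OddsLemma

/-!
# The non-table piece (J1L-T) of the cross term is a theorem in the pointwise regime
(blind cell PercRepro2, mine-a g10 — MINE-A.md §53.11)

Reveal the required cluster `S = C₂` in the world `T = {a₃ ∈ C₂, a₁ ∉ C₂}`; write
`g_u(S) = P_{G ∖ S}(u ∈ C(a₁))` (`delClusterProb`), `D = P(PD)`, `D_o = P(PD, o ∈ U)`, `γ = D_o/D`.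
**Regime**: `D · g_o(S) ≤ D_o` (i.e. `g_o(S) ≤ γ`) for every `S ∋ a₃`.  Then
`F₁(S) = 1[a₃ ∈ S] · (D_o − D · g_o(S))` is a nonnegative INCREASING cluster functional, `1 − g_b` is
increasing, and BHK06 Thm 1.3 (`bhk_induced`, root `a₂`, avoided `{a₁}`) gives
`E[F₁ g_b 1_Q] · P(Q) ≤ E[F₁ 1_Q] · E[g_b 1_Q]` — the centred-product statement (RV⁻) of §53.11.  With
Harris in `G ∖ S` (`g_ob ≥ g_o g_b`) and the tower identities (`prob_clusterIn_inter_avoid_eq_expect`)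
this is the cleared piece **(J1L-T)**: `P(Q) · (D · P(T, oL, bL) − D_o · P(T, bL)) ≥ P(Q, bL) · (D · P(T, oL) − D_o · P(T))`,
i.e. `Cov_μ(1[b ∈ C₁], 1[a₃ ∈ C₂] (1[o ∈ C₁] − γ)) ≥ 0` (`J1LT_of_regime`).  This is the `C₂`-side twin
of the monotone-host regime for PC1 (`CaseOneRegime.lean`); outside the regime the statement is
census-true but has no certificate over the marked-table toolbox (§53.9).
-/

namespace Summit.Ventures.PercRepro2

open UnionCluster

namespace J1Regime

section Regime

variable {V : Type*} {E : Type*} [Fintype E] [DecidableEq E] [Fintype V] [DecidableEq V]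
  {R : Type*} [Field R] [LinearOrder R] [IsStrictOrderedRing R]

variable (p : E → R) (ends : E → Sym2 V) (o a₁ a₂ a₃ b : V)

local notation3 "Q" => avoidAll ends a₂ {a₁}
local notation3 "oL" => connEvent ends a₁ o
local notation3 "bL" => connEvent ends a₁ b
local notation3 "tH" => connEvent ends a₂ a₃
local notation3 "gₒ" => delClusterProb p ends a₁ {W : Set V | o ∈ W}
local notation3 "g_b" => delClusterProb p ends a₁ {W : Set V | b ∈ W}
local notation3 "gₒb" => delClusterProb p ends a₁ ({W : Set V | o ∈ W} ∩ {W : Set V | b ∈ W})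
local notation3 "𝟙A" => ({W : Set V | a₃ ∈ W} : Set (Set V)).indicator (1 : Set V → R)
local notation3 "𝟙Q" => (avoidAll ends a₂ {a₁}).indicator (1 : Config E → R)

omit [Fintype E] [DecidableEq E] [Fintype V] [DecidableEq V] in
/-- The event `{C(a₁) ∈ 𝓥 in G ∖ W}` is increasing for an up-set `𝓥`. -/
lemma isUpperSet_delEvent (W : Set V) {𝓥 : Set (Set V)} (h𝓥 : IsUpperSet 𝓥) :
    IsUpperSet {ω : Config E | cluster ends (delConfig ends W ω) a₁ ∈ 𝓥} := by
  intro ω ω' h hω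
  exact h𝓥 (cluster_mono (BHKMixed.delConfig_mono_config ends W h) a₁) hω

omit [Fintype V] [DecidableEq V] in
/-- **Harris in `G ∖ W`**: `g_o(W) · g_b(W) ≤ g_ob(W)`. -/
lemma harris_del (hp : IsProbVec p) (W : Set V) : gₒ W * g_b W ≤ gₒb W := by
  unfold delClusterProb
  have h := prob_mul_prob_le_prob_inter hp (isUpperSet_delEvent ends a₁ W (isUpperSet_mem_setOf o))
    (isUpperSet_delEvent ends a₁ W (isUpperSet_mem_setOf b))
  have e : {ω : Config E | cluster ends (delConfig ends W ω) a₁ ∈ {W : Set V | o ∈ W}} ∩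
      {ω : Config E | cluster ends (delConfig ends W ω) a₁ ∈ {W : Set V | b ∈ W}} =
      {ω : Config E | cluster ends (delConfig ends W ω) a₁ ∈ {W : Set V | o ∈ W} ∩ {W : Set V | b ∈ W}} := by
    ext ω; simp only [Set.mem_inter_iff, Set.mem_setOf_eq]
  rwa [e] at h

/-! ### The tower identities (root `a₂`, avoided `{a₁}`) -/

omit [DecidableEq V] [LinearOrder R] [IsStrictOrderedRing R] in
/-- `P(T ∩ oL ∩ bL) = E[1_A(C₂) · g_ob(C₂) · 1_Q]`. -/
lemma tower_ob : prob p (Q ∩ tH ∩ oL ∩ bL) =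
    expect p (fun ω => 𝟙A (cluster ends ω a₂) * gₒb (cluster ends ω a₂) * 𝟙Q ω) := by
  have h := prob_clusterIn_inter_avoid_eq_expect p ends a₂ a₁ (X := {a₁}) (Finset.mem_singleton_self a₁)
    {W : Set V | a₃ ∈ W} ({W : Set V | o ∈ W} ∩ {W : Set V | b ∈ W})
  rw [← BHKMixed.clusterInEvent_inter, ← connEvent_eq_clusterInEvent ends a₂ a₃,
    ← connEvent_eq_clusterInEvent ends a₁ o, ← connEvent_eq_clusterInEvent ends a₁ b] at h
  have e : tH ∩ (oL ∩ bL) ∩ Q = Q ∩ tH ∩ oL ∩ bL := by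
    ext ω; simp only [Set.mem_inter_iff]; tauto
  rw [e] at h
  exact h

omit [DecidableEq V] [LinearOrder R] [IsStrictOrderedRing R] in
/-- `P(T ∩ oL) = E[1_A(C₂) · g_o(C₂) · 1_Q]`. -/
lemma tower_o : prob p (Q ∩ tH ∩ oL) =
    expect p (fun ω => 𝟙A (cluster ends ω a₂) * gₒ (cluster ends ω a₂) * 𝟙Q ω) := by
  have h := prob_clusterIn_inter_avoid_eq_expect p ends a₂ a₁ (X := {a₁}) (Finset.mem_singleton_self a₁)
    {W : Set V | a₃ ∈ W} {W : Set V | o ∈ W}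
  rw [← connEvent_eq_clusterInEvent ends a₂ a₃, ← connEvent_eq_clusterInEvent ends a₁ o] at h
  have e : tH ∩ oL ∩ Q = Q ∩ tH ∩ oL := by ext ω; simp only [Set.mem_inter_iff]; tauto
  rw [e] at h
  exact h

omit [DecidableEq V] [LinearOrder R] [IsStrictOrderedRing R] in
/-- `P(T ∩ bL) = E[1_A(C₂) · g_b(C₂) · 1_Q]`. -/
lemma tower_b : prob p (Q ∩ tH ∩ bL) =
    expect p (fun ω => 𝟙A (cluster ends ω a₂) * g_b (cluster ends ω a₂) * 𝟙Q ω) := by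
  have h := prob_clusterIn_inter_avoid_eq_expect p ends a₂ a₁ (X := {a₁}) (Finset.mem_singleton_self a₁)
    {W : Set V | a₃ ∈ W} {W : Set V | b ∈ W}
  rw [← connEvent_eq_clusterInEvent ends a₂ a₃, ← connEvent_eq_clusterInEvent ends a₁ b] at h
  have e : tH ∩ bL ∩ Q = Q ∩ tH ∩ bL := by ext ω; simp only [Set.mem_inter_iff]; tauto
  rw [e] at h
  exact h

omit [DecidableEq V] [LinearOrder R] [IsStrictOrderedRing R] in
/-- `P(T) = E[1_A(C₂) · 1_Q]`. -/
lemma tower_A : prob p (Q ∩ tH) = expect p (fun ω => 𝟙A (cluster ends ω a₂) * 𝟙Q ω) := by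
  have h := prob_clusterIn_inter_avoid_eq_expect p ends a₂ a₁ (X := {a₁}) (Finset.mem_singleton_self a₁)
    {W : Set V | a₃ ∈ W} Set.univ
  rw [← connEvent_eq_clusterInEvent ends a₂ a₃] at h
  have e1 : clusterInEvent ends a₁ Set.univ = Set.univ := by ext ω; simp [clusterInEvent]
  have e2 : tH ∩ Set.univ ∩ Q = Q ∩ tH := by ext ω; simp only [Set.mem_inter_iff, Set.mem_univ]; tauto
  rw [e1, e2] at h
  have e3 : ∀ W : Set V, delClusterProb p ends a₁ Set.univ W = 1 := by
    intro W; unfold delClusterProb; simp [prob_univ]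
  simp only [e3, mul_one] at h
  exact h

omit [DecidableEq V] [LinearOrder R] [IsStrictOrderedRing R] in
/-- `P(Q ∩ bL) = E[g_b(C₂) · 1_Q]`. -/
lemma tower_Qb : prob p (Q ∩ bL) = expect p (fun ω => g_b (cluster ends ω a₂) * 𝟙Q ω) := by
  have h := prob_clusterIn_inter_avoid_eq_expect p ends a₂ a₁ (X := {a₁}) (Finset.mem_singleton_self a₁)
    Set.univ {W : Set V | b ∈ W}
  rw [← connEvent_eq_clusterInEvent ends a₁ b] at h
  have e1 : clusterInEvent ends a₂ Set.univ = Set.univ := by ext ω; simp [clusterInEvent]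
  have e2 : Set.univ ∩ bL ∩ Q = Q ∩ bL := by ext ω; simp only [Set.mem_inter_iff, Set.mem_univ]; tauto
  rw [e1, e2] at h
  simp only [Set.indicator_univ, Pi.one_apply, one_mul] at h
  exact h

/-! ### The BHK step under the regime hypothesis -/

/-- **(RV⁻) in the regime** (BHK06 Thm 1.3 on the cluster of `a₂` avoiding `a₁`): with
`F₁(S) = 1[a₃ ∈ S] (D_o − D g_o(S))` increasing under `hreg`,
`E[F₁(C₂) g_b(C₂) 1_Q] · P(Q) ≤ E[F₁(C₂) 1_Q] · E[g_b(C₂) 1_Q]`. -/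
theorem rvminus_regime (hp : IsProbVec p) {D Do : R} (hD : 0 ≤ D)
    (hreg : ∀ W : Set V, a₃ ∈ W → D * gₒ W ≤ Do) :
    expect p (fun ω => 𝟙A (cluster ends ω a₂) * (Do - D * gₒ (cluster ends ω a₂)) *
        g_b (cluster ends ω a₂) * 𝟙Q ω) * prob p Q ≤
      expect p (fun ω => 𝟙A (cluster ends ω a₂) * (Do - D * gₒ (cluster ends ω a₂)) * 𝟙Q ω) *
        expect p (fun ω => g_b (cluster ends ω a₂) * 𝟙Q ω) := by
  have hgo : Antitone gₒ := delClusterProb_anti p hp ends a₁ (isUpperSet_mem_setOf o)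
  have hgb : Antitone g_b := delClusterProb_anti p hp ends a₁ (isUpperSet_mem_setOf b)
  -- the two functionals
  set F₁ : Set V → R := fun W => 𝟙A W * (Do - D * gₒ W) with hF₁def
  set F₂ : Set V → R := fun W => 1 - g_b W with hF₂def
  have hF₁0 : ∀ W, 0 ≤ F₁ W := by
    intro W
    simp only [hF₁def]
    by_cases hW : a₃ ∈ W
    · rw [Set.indicator_of_mem (show W ∈ {W : Set V | a₃ ∈ W} from hW), Pi.one_apply, one_mul]
      linarith [hreg W hW]
    · rw [Set.indicator_of_notMem (show W ∉ {W : Set V | a₃ ∈ W} from hW), zero_mul]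
  have hF₁ : Monotone F₁ := by
    intro W W' hWW'
    simp only [hF₁def]
    by_cases hW : a₃ ∈ W
    · have hW' : a₃ ∈ W' := hWW' hW
      rw [Set.indicator_of_mem (show W ∈ {W : Set V | a₃ ∈ W} from hW),
        Set.indicator_of_mem (show W' ∈ {W : Set V | a₃ ∈ W} from hW')]
      simp only [Pi.one_apply, one_mul]
      have := hgo hWW'
      nlinarith [this, hD]
    · rw [Set.indicator_of_notMem (show W ∉ {W : Set V | a₃ ∈ W} from hW), zero_mul]
      exact hF₁0 W'
  have hF₂ : Monotone F₂ := fun W W' h => by simp only [hF₂def]; linarith [hgb h]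
  have hF₂0 : ∀ W, 0 ≤ F₂ W := fun W => by
    simp only [hF₂def]; linarith [delClusterProb_le_one p hp ends a₁ {W : Set V | b ∈ W} W]
  have h := bhk_induced p hp ends a₂ hF₁ hF₂ hF₁0 hF₂0 Finset.univ {a₁} {a₁} (Finset.subset_univ _)
    (Finset.subset_univ _)
  rw [Finset.inter_self, Finset.union_self, REvent_univ_singleton, J1Coinc.Qc'_eq ends a₁ a₂] at h
  change expect p (fun ω => clusterObs ends Finset.univ a₂ F₁ ω * 𝟙Q ω) *
      expect p (fun ω => clusterObs ends Finset.univ a₂ F₂ ω * 𝟙Q ω) ≤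
    expect p (fun ω => clusterObs ends Finset.univ a₂ (F₁ * F₂) ω * 𝟙Q ω) * prob p Q at h
  simp only [clusterObs_apply, clusterIn_univ, Pi.mul_apply, hF₁def, hF₂def] at h
  -- expand the expectations
  have eF₂ : expect p (fun ω => (1 - g_b (cluster ends ω a₂)) * 𝟙Q ω) =
      prob p Q - expect p (fun ω => g_b (cluster ends ω a₂) * 𝟙Q ω) := by
    rw [prob_eq_expect_indicator, ← expect_sub]
    congr 1; funext ω; simp only [Pi.sub_apply]; ring
  have eF₁₂ : expect p (fun ω => 𝟙A (cluster ends ω a₂) * (Do - D * gₒ (cluster ends ω a₂)) *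
      (1 - g_b (cluster ends ω a₂)) * 𝟙Q ω) =
      expect p (fun ω => 𝟙A (cluster ends ω a₂) * (Do - D * gₒ (cluster ends ω a₂)) * 𝟙Q ω) -
        expect p (fun ω => 𝟙A (cluster ends ω a₂) * (Do - D * gₒ (cluster ends ω a₂)) *
          g_b (cluster ends ω a₂) * 𝟙Q ω) := by
    rw [← expect_sub]
    congr 1; funext ω; simp only [Pi.sub_apply]; ring
  rw [eF₂, eF₁₂] at h
  nlinarith [h]

/-- **(J1L-T) in the regime**: if `D · g_o(S) ≤ D_o` for every `S ∋ a₃`, then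
`P(Q) · (D · P(T, oL, bL) − D_o · P(T, bL)) ≥ P(Q, bL) · (D · P(T, oL) − D_o · P(T))`, i.e.
`Cov_μ(1[b ∈ C₁], 1[a₃ ∈ C₂] (1[o ∈ C₁] − γ)) ≥ 0` with `D = P(PD)`, `D_o = P(PD, o ∈ U)`, `γ = D_o/D`. -/
theorem J1LT_of_regime (hp : IsProbVec p)
    (hreg : ∀ W : Set V, a₃ ∈ W →
      prob p (PDEvent ends a₁ a₂ a₃) * gₒ W ≤ CovForm.Do p ends o a₁ a₂ a₃) :
    prob p (Q ∩ bL) *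
        (prob p (PDEvent ends a₁ a₂ a₃) * prob p (Q ∩ tH ∩ oL) -
          CovForm.Do p ends o a₁ a₂ a₃ * prob p (Q ∩ tH)) ≤
      prob p Q *
        (prob p (PDEvent ends a₁ a₂ a₃) * prob p (Q ∩ tH ∩ oL ∩ bL) -
          CovForm.Do p ends o a₁ a₂ a₃ * prob p (Q ∩ tH ∩ bL)) := by
  set D := prob p (PDEvent ends a₁ a₂ a₃) with hDdef
  set Do' := CovForm.Do p ends o a₁ a₂ a₃ with hDodef
  have hD : 0 ≤ D := prob_nonneg hp _
  have key := rvminus_regime p ends o a₁ a₂ a₃ b hp hD hreg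
  -- the six expectations
  set e1 := expect p (fun ω => 𝟙A (cluster ends ω a₂) * gₒ (cluster ends ω a₂) * 𝟙Q ω) with he1
  set e2 := expect p (fun ω => 𝟙A (cluster ends ω a₂) * g_b (cluster ends ω a₂) * 𝟙Q ω) with he2
  set e3 := expect p (fun ω => 𝟙A (cluster ends ω a₂) * gₒ (cluster ends ω a₂) *
    g_b (cluster ends ω a₂) * 𝟙Q ω) with he3
  set e4 := expect p (fun ω => 𝟙A (cluster ends ω a₂) * 𝟙Q ω) with he4
  set e5 := expect p (fun ω => g_b (cluster ends ω a₂) * 𝟙Q ω) with he5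
  set e6 := expect p (fun ω => 𝟙A (cluster ends ω a₂) * gₒb (cluster ends ω a₂) * 𝟙Q ω) with he6
  -- linear expansions of the two `F₁`-expectations
  have x1 : expect p (fun ω => 𝟙A (cluster ends ω a₂) * (Do' - D * gₒ (cluster ends ω a₂)) *
      g_b (cluster ends ω a₂) * 𝟙Q ω) = Do' * e2 - D * e3 := by
    rw [he2, he3, ← expect_const_mul, ← expect_const_mul, ← expect_sub]
    congr 1; funext ω; simp only [Pi.sub_apply]; ring
  have x2 : expect p (fun ω => 𝟙A (cluster ends ω a₂) * (Do' - D * gₒ (cluster ends ω a₂)) * 𝟙Q ω) =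
      Do' * e4 - D * e1 := by
    rw [he4, he1, ← expect_const_mul, ← expect_const_mul, ← expect_sub]
    congr 1; funext ω; simp only [Pi.sub_apply]; ring
  rw [x1, x2] at key
  -- Harris in `G ∖ S`: `e3 ≤ e6`
  have hH : e3 ≤ e6 := by
    rw [he3, he6]
    refine expect_mono hp fun ω => ?_
    have h1 := harris_del p ends o a₁ b hp (cluster ends ω a₂)
    have hA0 : 0 ≤ 𝟙A (cluster ends ω a₂) := Set.indicator_apply_nonneg fun _ => zero_le_one
    have hQ0 : 0 ≤ 𝟙Q ω := Set.indicator_apply_nonneg fun _ => zero_le_one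
    have := mul_le_mul_of_nonneg_left h1 (mul_nonneg hA0 hQ0)
    nlinarith [this, hA0, hQ0]
  -- assemble
  have hZ : 0 ≤ prob p Q := prob_nonneg hp _
  rw [tower_ob, tower_o, tower_b, tower_A, tower_Qb]
  rw [← he1, ← he2, ← he4, ← he5, ← he6]
  nlinarith [key, mul_nonneg hZ (mul_nonneg hD (sub_nonneg.2 hH))]

/-- **The mirror — mine-1's (ii) in the regime**: with the roots exchanged, if `P(PD) · g'_o(W) ≤ D_o` for every
`W ∋ a₃` where `g'_o(W) = P_{G∖W}(o ∈ C(a₂))`, then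
`P(Q, bH) · (D · P(T′, oH) − D_o · P(T′)) ≤ P(Q) · (D · P(T′, oH, bH) − D_o · P(T′, bH))`,
i.e. `Cov_μ(1[b ∈ C₂], 1[a₃ ∈ C₁] (1[o ∈ C₂] − γ)) ≥ 0` (`T′ = Q ∩ {a₃ ∈ C₁}`). -/
theorem J1HTp_of_regime (hp : IsProbVec p)
    (hreg : ∀ W : Set V, a₃ ∈ W →
      prob p (PDEvent ends a₁ a₂ a₃) * delClusterProb p ends a₂ {W : Set V | o ∈ W} W ≤
        CovForm.Do p ends o a₁ a₂ a₃) :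
    prob p (Q ∩ connEvent ends a₂ b) *
        (prob p (PDEvent ends a₁ a₂ a₃) * prob p (Q ∩ connEvent ends a₁ a₃ ∩ connEvent ends a₂ o) -
          CovForm.Do p ends o a₁ a₂ a₃ * prob p (Q ∩ connEvent ends a₁ a₃)) ≤
      prob p Q *
        (prob p (PDEvent ends a₁ a₂ a₃) *
            prob p (Q ∩ connEvent ends a₁ a₃ ∩ connEvent ends a₂ o ∩ connEvent ends a₂ b) -
          CovForm.Do p ends o a₁ a₂ a₃ * prob p (Q ∩ connEvent ends a₁ a₃ ∩ connEvent ends a₂ b)) := by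
  have h := J1LT_of_regime p ends o a₂ a₁ a₃ b hp (by
    intro W hW
    have := hreg W hW
    rwa [CovForm.PDEvent_root_swap, CovForm.Do_root_swap] at this)
  rwa [CovForm.avoidAll_root_swap, CovForm.PDEvent_root_swap, CovForm.Do_root_swap] at h

/-- **The unconditional half of (RV⁻)** — no regime hypothesis: with the POSITIVE PART
`F⁺(S) = 1[a₃ ∈ S] · max (D_o − D g_o(S)) 0` (nonnegative and increasing for every instance),
`E[F⁺(C₂) g_b(C₂) 1_Q] · P(Q) ≤ E[F⁺(C₂) 1_Q] · E[g_b(C₂) 1_Q]`: the part of the centred product carried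
by the hosts with `g_o(S) ≤ γ` is always `≥ 0`; the whole non-table content of (J1L-T) sits on the
`o`-rich hosts `{S ∋ a₃ : g_o(S) > γ}` (MINE-A.md §53.13). -/
theorem rvminus_plus (hp : IsProbVec p) {D Do : R} (hD : 0 ≤ D) :
    expect p (fun ω => 𝟙A (cluster ends ω a₂) * max (Do - D * gₒ (cluster ends ω a₂)) 0 *
        g_b (cluster ends ω a₂) * 𝟙Q ω) * prob p Q ≤
      expect p (fun ω => 𝟙A (cluster ends ω a₂) * max (Do - D * gₒ (cluster ends ω a₂)) 0 * 𝟙Q ω) *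
        expect p (fun ω => g_b (cluster ends ω a₂) * 𝟙Q ω) := by
  have hgo : Antitone gₒ := delClusterProb_anti p hp ends a₁ (isUpperSet_mem_setOf o)
  have hgb : Antitone g_b := delClusterProb_anti p hp ends a₁ (isUpperSet_mem_setOf b)
  set F₁ : Set V → R := fun W => 𝟙A W * max (Do - D * gₒ W) 0 with hF₁def
  set F₂ : Set V → R := fun W => 1 - g_b W with hF₂def
  have hF₁0 : ∀ W, 0 ≤ F₁ W := fun W => by
    simp only [hF₁def]
    exact mul_nonneg (Set.indicator_apply_nonneg fun _ => zero_le_one) (le_max_right _ _)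
  have hF₁ : Monotone F₁ := by
    intro W W' hWW'
    simp only [hF₁def]
    by_cases hW : a₃ ∈ W
    · have hW' : a₃ ∈ W' := hWW' hW
      rw [Set.indicator_of_mem (show W ∈ {W : Set V | a₃ ∈ W} from hW),
        Set.indicator_of_mem (show W' ∈ {W : Set V | a₃ ∈ W} from hW')]
      simp only [Pi.one_apply, one_mul]
      have := hgo hWW'
      exact max_le_max (by nlinarith [this, hD]) le_rfl
    · rw [Set.indicator_of_notMem (show W ∉ {W : Set V | a₃ ∈ W} from hW), zero_mul]
      exact hF₁0 W'
  have hF₂ : Monotone F₂ := fun W W' h => by simp only [hF₂def]; linarith [hgb h]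
  have hF₂0 : ∀ W, 0 ≤ F₂ W := fun W => by
    simp only [hF₂def]; linarith [delClusterProb_le_one p hp ends a₁ {W : Set V | b ∈ W} W]
  have h := bhk_induced p hp ends a₂ hF₁ hF₂ hF₁0 hF₂0 Finset.univ {a₁} {a₁} (Finset.subset_univ _)
    (Finset.subset_univ _)
  rw [Finset.inter_self, Finset.union_self, REvent_univ_singleton, J1Coinc.Qc'_eq ends a₁ a₂] at h
  change expect p (fun ω => clusterObs ends Finset.univ a₂ F₁ ω * 𝟙Q ω) *
      expect p (fun ω => clusterObs ends Finset.univ a₂ F₂ ω * 𝟙Q ω) ≤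
    expect p (fun ω => clusterObs ends Finset.univ a₂ (F₁ * F₂) ω * 𝟙Q ω) * prob p Q at h
  simp only [clusterObs_apply, clusterIn_univ, Pi.mul_apply, hF₁def, hF₂def] at h
  have eF₂ : expect p (fun ω => (1 - g_b (cluster ends ω a₂)) * 𝟙Q ω) =
      prob p Q - expect p (fun ω => g_b (cluster ends ω a₂) * 𝟙Q ω) := by
    rw [prob_eq_expect_indicator, ← expect_sub]
    congr 1; funext ω; simp only [Pi.sub_apply]; ring
  have eF₁₂ : expect p (fun ω => 𝟙A (cluster ends ω a₂) * max (Do - D * gₒ (cluster ends ω a₂)) 0 *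
      (1 - g_b (cluster ends ω a₂)) * 𝟙Q ω) =
      expect p (fun ω => 𝟙A (cluster ends ω a₂) * max (Do - D * gₒ (cluster ends ω a₂)) 0 * 𝟙Q ω) -
        expect p (fun ω => 𝟙A (cluster ends ω a₂) * max (Do - D * gₒ (cluster ends ω a₂)) 0 *
          g_b (cluster ends ω a₂) * 𝟙Q ω) := by
    rw [← expect_sub]
    congr 1; funext ω; simp only [Pi.sub_apply]; ring
  rw [eF₂, eF₁₂] at h
  nlinarith [h]

omit [DecidableEq V] in
/-- **(J1L-T) ⟸ (RV⁻)**, unconditionally: if the centred-product inequality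
`E[1_A (D_o − D g_o) g_b 1_Q] · P(Q) ≤ E[1_A (D_o − D g_o) 1_Q] · E[g_b 1_Q]` holds (with `D = P(PD)`,
`D_o = P(PD, o ∈ U)`), then the cleared piece (J1L-T) holds — Harris in `G ∖ S` and the tower
identities; `J1LT_of_regime` is this reduction composed with `rvminus_regime`. -/
theorem J1LT_of_rvminus (hp : IsProbVec p)
    (hrv : expect p (fun ω => 𝟙A (cluster ends ω a₂) *
        (CovForm.Do p ends o a₁ a₂ a₃ - prob p (PDEvent ends a₁ a₂ a₃) * gₒ (cluster ends ω a₂)) *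
        g_b (cluster ends ω a₂) * 𝟙Q ω) * prob p Q ≤
      expect p (fun ω => 𝟙A (cluster ends ω a₂) *
        (CovForm.Do p ends o a₁ a₂ a₃ - prob p (PDEvent ends a₁ a₂ a₃) * gₒ (cluster ends ω a₂)) * 𝟙Q ω) *
        expect p (fun ω => g_b (cluster ends ω a₂) * 𝟙Q ω)) :
    prob p (Q ∩ bL) *
        (prob p (PDEvent ends a₁ a₂ a₃) * prob p (Q ∩ tH ∩ oL) -
          CovForm.Do p ends o a₁ a₂ a₃ * prob p (Q ∩ tH)) ≤
      prob p Q *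
        (prob p (PDEvent ends a₁ a₂ a₃) * prob p (Q ∩ tH ∩ oL ∩ bL) -
          CovForm.Do p ends o a₁ a₂ a₃ * prob p (Q ∩ tH ∩ bL)) := by
  set D := prob p (PDEvent ends a₁ a₂ a₃) with hDdef
  set Do' := CovForm.Do p ends o a₁ a₂ a₃ with hDodef
  have hD : 0 ≤ D := prob_nonneg hp _
  set e1 := expect p (fun ω => 𝟙A (cluster ends ω a₂) * gₒ (cluster ends ω a₂) * 𝟙Q ω) with he1
  set e2 := expect p (fun ω => 𝟙A (cluster ends ω a₂) * g_b (cluster ends ω a₂) * 𝟙Q ω) with he2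
  set e3 := expect p (fun ω => 𝟙A (cluster ends ω a₂) * gₒ (cluster ends ω a₂) *
    g_b (cluster ends ω a₂) * 𝟙Q ω) with he3
  set e4 := expect p (fun ω => 𝟙A (cluster ends ω a₂) * 𝟙Q ω) with he4
  set e5 := expect p (fun ω => g_b (cluster ends ω a₂) * 𝟙Q ω) with he5
  set e6 := expect p (fun ω => 𝟙A (cluster ends ω a₂) * gₒb (cluster ends ω a₂) * 𝟙Q ω) with he6
  have x1 : expect p (fun ω => 𝟙A (cluster ends ω a₂) * (Do' - D * gₒ (cluster ends ω a₂)) *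
      g_b (cluster ends ω a₂) * 𝟙Q ω) = Do' * e2 - D * e3 := by
    rw [he2, he3, ← expect_const_mul, ← expect_const_mul, ← expect_sub]
    congr 1; funext ω; simp only [Pi.sub_apply]; ring
  have x2 : expect p (fun ω => 𝟙A (cluster ends ω a₂) * (Do' - D * gₒ (cluster ends ω a₂)) * 𝟙Q ω) =
      Do' * e4 - D * e1 := by
    rw [he4, he1, ← expect_const_mul, ← expect_const_mul, ← expect_sub]
    congr 1; funext ω; simp only [Pi.sub_apply]; ring
  rw [x1, x2] at hrv
  have hH : e3 ≤ e6 := by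
    rw [he3, he6]
    refine expect_mono hp fun ω => ?_
    have h1 := harris_del p ends o a₁ b hp (cluster ends ω a₂)
    have hA0 : 0 ≤ 𝟙A (cluster ends ω a₂) := Set.indicator_apply_nonneg fun _ => zero_le_one
    have hQ0 : 0 ≤ 𝟙Q ω := Set.indicator_apply_nonneg fun _ => zero_le_one
    have := mul_le_mul_of_nonneg_left h1 (mul_nonneg hA0 hQ0)
    nlinarith [this, hA0, hQ0]
  have hZ : 0 ≤ prob p Q := prob_nonneg hp _
  rw [tower_ob, tower_o, tower_b, tower_A, tower_Qb]
  rw [← he1, ← he2, ← he4, ← he5, ← he6]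
  nlinarith [hrv, mul_nonneg hZ (mul_nonneg hD (sub_nonneg.2 hH))]

end Regime

end J1Regime

end Summit.Ventures.PercRepro2
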